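import Literature.Geometry.Lorentzian.CauchyProblemLocalUniquenessReduced
import Literature.Geometry.Lorentzian.ConnectionNaturality
import Literature.Geometry.Lorentzian.CurvatureNaturality
import Literature.Geometry.Lorentzian.ChartMetricCoord
import HarnessLib

/-!
# The coordinate metric of a data embedding in a chart of the maximal atlas: smoothness of its
# components and the vacuum equations for them

Fourth support file (everything proved, no named facts) for the named fact
`Literature.Geometry.Lorentzian.hawkingEllis_locallyUnique_vacuumDevelopment`, addressing the
"dictionary" between the abstract spacetime of a (vacuum) data embedding `𝒮 = (M, g, …)` and the
coordinate objects in a chart `ψ ∈ IsManifold.maximalAtlas (𝓡 m) ∞ M` required by the hypothesis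
`hre` of `hawkingEllis_locallyUnique_vacuumDevelopment_of_reducedEquations`
(`CauchyProblemLocalUniquenessReduced.lean`). It is the dimension-`m` version, for Lorentzian
use, of `AtlasChartMetric.lean` (written for `E3` and Riemannian `3`-manifolds):

* `CoordChart.target ψ`, `CoordChart.inv ψ` — the chart target as an open submanifold of
  `EuclideanSpace ℝ (Fin m)` and the inverse chart, smooth with invertible differential;
* `CoordChart.metric g hψ = Ψ^* g` — the metric transported to the target
  (`PseudoRiemannianMetric.comap` along the inverse chart `Ψ`), its representative
  `CoordChart.metricRepr` on the model space and its smoothness (`contDiffAt_metricRepr`);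
* `CoordChart.pullbackBilin_symm_apply_eq_metricRepr`, `CoordChart.bilinComps_pullbackBilin_symm`,
  `CoordChart.contDiffOn_metricRepr` — on the target the representative *is* the coordinate metric
  `ψ⁻¹* g = pullbackBilin ψ.symm g.val` of `CauchyProblemLocalUniquenessProofs.lean` (pointwise, and
  through the components `bilinComps`), and it is `C^∞` there;
* **`CoordChart.ricAt_metricRepr_eq_zero`** — for a vacuum data embedding the coordinate Ricci
  form of the representative vanishes on the target (`Ric(Ψ^* g) = Ψ^* Ric(g) = 0`,
  `PseudoRiemannianMetric.ricci_comap_apply`, O'Neill 1983, Ch. 3, Prop. 3.59, and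
  `OpensChart.ricci_eq_ricAt`, Lemma 3.52): the Einstein vacuum equations for the component
  functions, in the coordinate tensor calculus `MetricCoord` of `CoordCurvature.lean`;
* **`CauchyDevelopment.contDiffOn_coordMetricComps`** — the component functions
  `coordMetricComps 𝒮 ψ` (time coordinate split off) are `C^∞` on `coordSplit (ψ.target)`.

## References

* B. O'Neill, *Semi-Riemannian geometry with applications to relativity*, Academic Press 1983,
  Ch. 3, Prop. 3.13, Lemma 3.52, Prop. 3.59, pp. 90–91. [ONeill1983]
* S. W. Hawking, G. F. R. Ellis, *The large scale structure of space-time*, CUP 1973, §7.5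
  (coordinate form of the vacuum equations in the harmonic charts, (7.42)–(7.46)). [HawkingEllis1973CUP]
-/

noncomputable section

set_option maxSynthPendingDepth 3

open Bundle Set Function Filter VectorField TopologicalSpace Manifold
open scoped Manifold ContDiff Topology

namespace Literature.Geometry.Lorentzian

universe u

namespace CoordChart

variable {m : ℕ} {M : Type*} [TopologicalSpace M]
  {ψ : OpenPartialHomeomorph M (EuclideanSpace ℝ (Fin m))}

/-! ### The chart target and the inverse chart -/

variable (ψ) in
/-- The target of the chart `ψ` as an open submanifold of `EuclideanSpace ℝ (Fin m)`. [folklore] -/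
abbrev target : Opens (EuclideanSpace ℝ (Fin m)) :=
  ⟨ψ.target, ψ.open_target⟩

variable (ψ) in
/-- The inverse chart `Ψ : ψ.target → M`, `Ψ p = ψ⁻¹ p`. [folklore] -/
def inv : target ψ → M :=
  fun p ↦ ψ.symm p

/-- Unfolding lemma: `inv ψ p = ψ⁻¹ p`. [folklore] -/
@[simp]
lemma inv_apply (p : target ψ) : inv ψ p = ψ.symm p := rfl

/-- The inverse chart lands in the chart source. [folklore] -/
lemma inv_mem_source (p : target ψ) : inv ψ p ∈ ψ.source :=
  ψ.map_target p.2

/-- `ψ (ψ⁻¹ p) = p` on the target. [folklore] -/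
@[simp]
lemma apply_inv (p : target ψ) : ψ (inv ψ p) = p :=
  ψ.right_inv p.2

variable [ChartedSpace (EuclideanSpace ℝ (Fin m)) M]

/-- A chart of the maximal `C^∞` atlas is differentiable with differentiable inverse. [folklore] -/
theorem mdifferentiable_chart (hψ : ψ ∈ IsManifold.maximalAtlas (𝓡 m) ∞ M) :
    ψ.MDifferentiable (𝓡 m) (𝓡 m) :=
  ⟨(contMDiffOn_of_mem_maximalAtlas hψ).mdifferentiableOn (by simp),
    (contMDiffOn_symm_of_mem_maximalAtlas hψ).mdifferentiableOn (by simp)⟩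

/-- The inverse chart is smooth (`C^{∞ + 1} = C^∞`, the regularity asked by
`PseudoRiemannianMetric.comap`). [folklore] -/
theorem contMDiff_inv (hψ : ψ ∈ IsManifold.maximalAtlas (𝓡 m) ∞ M) :
    ContMDiff 𝓘(ℝ, EuclideanSpace ℝ (Fin m)) (𝓡 m) (∞ + 1) (inv ψ) := by
  have h : ((∞ : ℕ∞ω) + 1) = ∞ := rfl
  rw [h]
  exact (contMDiffOn_symm_of_mem_maximalAtlas hψ).comp_contMDiff contMDiff_subtype_val
    fun p ↦ p.2

/-- The inverse chart is smooth of class `C^∞`. [folklore] -/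
theorem contMDiff_inv' (hψ : ψ ∈ IsManifold.maximalAtlas (𝓡 m) ∞ M) :
    ContMDiff 𝓘(ℝ, EuclideanSpace ℝ (Fin m)) (𝓡 m) ∞ (inv ψ) :=
  (contMDiff_inv hψ).of_le le_self_add

/-- The differential of the inverse chart from the open submanifold is the differential of
`ψ.symm`. [folklore] -/
theorem mfderiv_inv (hψ : ψ ∈ IsManifold.maximalAtlas (𝓡 m) ∞ M) (p : target ψ) :
    mfderiv 𝓘(ℝ, EuclideanSpace ℝ (Fin m)) (𝓡 m) (inv ψ) p =
      mfderiv 𝓘(ℝ, EuclideanSpace ℝ (Fin m)) (𝓡 m) ψ.symm (p : EuclideanSpace ℝ (Fin m)) :=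
  mfderiv_comp_subtypeVal (f := ψ.symm) ((mdifferentiable_chart hψ).symm.mdifferentiableAt p.2)

/-- The differential of the inverse chart is invertible. [folklore] -/
theorem isInvertible_mfderiv_inv (hψ : ψ ∈ IsManifold.maximalAtlas (𝓡 m) ∞ M) (p : target ψ) :
    (mfderiv 𝓘(ℝ, EuclideanSpace ℝ (Fin m)) (𝓡 m) (inv ψ) p).IsInvertible := by
  rw [mfderiv_inv hψ]
  exact ⟨(mdifferentiable_chart hψ).symm.mfderiv p.2, rfl⟩

/-- The differential of the inverse chart is injective. [folklore] -/
theorem injective_mfderiv_inv (hψ : ψ ∈ IsManifold.maximalAtlas (𝓡 m) ∞ M) :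
    ∀ p : target ψ,
      Function.Injective (mfderiv 𝓘(ℝ, EuclideanSpace ℝ (Fin m)) (𝓡 m) (inv ψ) p) := fun p ↦ by
  rw [mfderiv_inv hψ]
  exact (mdifferentiable_chart hψ).symm.mfderiv_injective p.2

variable [IsManifold (𝓡 m) ∞ M]

/-! ### The transported metric on the chart target -/

variable (g : PseudoRiemannianMetric (𝓡 m) ∞ (EuclideanSpace ℝ (Fin m)) (TangentSpace (𝓡 m) : M → Type _))

/-- **The metric transported to the chart target**: `Ψ^* g` on the open submanifold `ψ.target`,
`(Ψ^* g)_p(a, b) = g_{Ψ p}(dΨ a, dΨ b)`; by construction `Ψ` is a local isometry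
`(ψ.target, Ψ^* g) → (M, g)`. O'Neill 1983, Ch. 3, pp. 90–91. [cite: ONeill1983, Ch. 3, pp. 90–91] -/
def metric (hψ : ψ ∈ IsManifold.maximalAtlas (𝓡 m) ∞ M) :
    PseudoRiemannianMetric 𝓘(ℝ, EuclideanSpace ℝ (Fin m)) ∞ (EuclideanSpace ℝ (Fin m))
      (TangentSpace 𝓘(ℝ, EuclideanSpace ℝ (Fin m)) : target ψ → Type _) :=
  g.comap PseudoRiemannianMetric.contMDiff_pullbackBilin_holds (inv ψ) (contMDiff_inv hψ)
    (injective_mfderiv_inv hψ) rfl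

/-- `(Ψ^* g)_p(a, b) = g_{Ψ p}(dΨ_p a, dΨ_p b)`. [cite: ONeill1983, Ch. 3, pp. 90–91] -/
@[simp]
theorem metric_val (hψ : ψ ∈ IsManifold.maximalAtlas (𝓡 m) ∞ M) (p : target ψ)
    (a b : EuclideanSpace ℝ (Fin m)) :
    (metric g hψ).val p a b =
      g.val (ψ.symm p) (mfderiv 𝓘(ℝ, EuclideanSpace ℝ (Fin m)) (𝓡 m) (inv ψ) p a)
        (mfderiv 𝓘(ℝ, EuclideanSpace ℝ (Fin m)) (𝓡 m) (inv ψ) p b) :=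
  rfl

/-- The representative of the transported metric: its components as a function on all of the
model space (junk value `0` off the target). [folklore] -/
def metricRepr (hψ : ψ ∈ IsManifold.maximalAtlas (𝓡 m) ∞ M) :
    EuclideanSpace ℝ (Fin m) → EuclideanSpace ℝ (Fin m) →L[ℝ] EuclideanSpace ℝ (Fin m) →L[ℝ] ℝ :=
  fun p ↦ by
    classical
    exact if hp : p ∈ ψ.target then (metric g hψ).val ⟨p, hp⟩ else 0

/-- The representative represents: `(Ψ^* g).val p = metricRepr p` on the target. [folklore] -/
theorem metric_val_eq_repr (hψ : ψ ∈ IsManifold.maximalAtlas (𝓡 m) ∞ M) :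
    ∀ p : target ψ, (metric g hψ).val p = metricRepr g hψ p := fun p ↦ by
  have hp : (p : EuclideanSpace ℝ (Fin m)) ∈ ψ.target := p.2
  simp only [metricRepr, dif_pos hp]

/-- The representative is smooth at the points of the target (`OpensChart.contDiffAt_repr`).
[folklore] -/
theorem contDiffAt_metricRepr (hψ : ψ ∈ IsManifold.maximalAtlas (𝓡 m) ∞ M) (p : target ψ) :
    ContDiffAt ℝ ∞ (metricRepr g hψ) p :=
  OpensChart.contDiffAt_repr (metric_val_eq_repr g hψ) p

/-- The representative is smooth on the target. [folklore] -/
theorem contDiffOn_metricRepr (hψ : ψ ∈ IsManifold.maximalAtlas (𝓡 m) ∞ M) :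
    ContDiffOn ℝ ∞ (metricRepr g hψ) ψ.target := fun p hp ↦
  (contDiffAt_metricRepr g hψ ⟨p, hp⟩).contDiffWithinAt

/-- **The representative is the coordinate metric** `ψ⁻¹* g = pullbackBilin ψ.symm g.val` on the
target (pointwise form; the two continuous bilinear maps live on the definitionally equal types
`TangentSpace (𝓡 m) p` and `EuclideanSpace ℝ (Fin m)`). [folklore] -/
theorem pullbackBilin_symm_apply_eq_metricRepr (hψ : ψ ∈ IsManifold.maximalAtlas (𝓡 m) ∞ M)
    {p : EuclideanSpace ℝ (Fin m)} (hp : p ∈ ψ.target) (a b : EuclideanSpace ℝ (Fin m)) :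
    pullbackBilin (I := 𝓡 m) (I' := 𝓡 m) ψ.symm g.val p a b = metricRepr g hψ p a b := by
  simp only [metricRepr, dif_pos hp]
  change g.val (ψ.symm p) (mfderiv (𝓡 m) (𝓡 m) ψ.symm p a) (mfderiv (𝓡 m) (𝓡 m) ψ.symm p b) =
    g.val (ψ.symm p) (mfderiv 𝓘(ℝ, EuclideanSpace ℝ (Fin m)) (𝓡 m) (inv ψ) ⟨p, hp⟩ a)
      (mfderiv 𝓘(ℝ, EuclideanSpace ℝ (Fin m)) (𝓡 m) (inv ψ) ⟨p, hp⟩ b)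
  rw [mfderiv_inv hψ]
  rfl

/-- The components of the coordinate metric are those of the representative on the target.
[folklore] -/
theorem bilinComps_pullbackBilin_symm (hψ : ψ ∈ IsManifold.maximalAtlas (𝓡 m) ∞ M)
    {p : EuclideanSpace ℝ (Fin m)} (hp : p ∈ ψ.target) :
    bilinComps m (pullbackBilin (I := 𝓡 m) (I' := 𝓡 m) ψ.symm g.val p) =
      bilinComps m (metricRepr g hψ p) := by
  refine PiLp.ext fun ab ↦ ?_
  obtain ⟨a, b⟩ := ab
  rw [bilinComps_apply, bilinComps_apply]
  exact pullbackBilin_symm_apply_eq_metricRepr g hψ hp _ _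

/-- **The vacuum equations in the chart.** If `Ric(g) = 0` then the coordinate Ricci form of the
representative vanishes on the target: `Ric(Ψ^* g) = Ψ^* Ric(g)` (O'Neill 1983, Ch. 3, Prop. 3.59)
and the abstract Ricci tensor of a metric on an open subset of the model space is `ricAt` of its
components (Lemma 3.52, `OpensChart.ricci_eq_ricAt`). [cite: ONeill1983, Ch. 3, Prop. 3.59] -/
theorem ricAt_metricRepr_eq_zero [Fact (1 ≤ m)] (hψ : ψ ∈ IsManifold.maximalAtlas (𝓡 m) ∞ M)
    [g.HasLeviCivita] (hRic : g.IsRicciFlat) {p : EuclideanSpace ℝ (Fin m)} (hp : p ∈ ψ.target)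
    (Y₀ Z₀ : EuclideanSpace ℝ (Fin m)) :
    MetricCoord.ricAt (metricRepr g hψ) p Y₀ Z₀ = 0 := by
  haveI hLC : (metric g hψ).HasLeviCivita := (metric g hψ).hasLeviCivita
  haveI hLC' : (g.comap PseudoRiemannianMetric.contMDiff_pullbackBilin_holds (inv ψ) (contMDiff_inv hψ)
      (injective_mfderiv_inv hψ) rfl).HasLeviCivita := hLC
  have h1 := OpensChart.ricci_eq_ricAt (metric_val_eq_repr g hψ) ⟨p, hp⟩ Y₀ Z₀
  rw [← h1]
  have key : (metric g hψ).ricci ⟨p, hp⟩ Y₀ Z₀ = g.ricci (inv ψ ⟨p, hp⟩)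
      (mfderiv 𝓘(ℝ, EuclideanSpace ℝ (Fin m)) (𝓡 m) (inv ψ) ⟨p, hp⟩ Y₀)
      (mfderiv 𝓘(ℝ, EuclideanSpace ℝ (Fin m)) (𝓡 m) (inv ψ) ⟨p, hp⟩ Z₀) :=
    PseudoRiemannianMetric.ricci_comap_apply g PseudoRiemannianMetric.contMDiff_pullbackBilin_holds
      (Φ := inv ψ) (contMDiff_inv hψ) (injective_mfderiv_inv hψ) rfl ⟨p, hp⟩ Y₀ Z₀
  rw [key, hRic (inv ψ ⟨p, hp⟩)]
  rfl

end CoordChart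

/-! ### Consequences for the component functions of a data embedding -/

section Data

variable {n : ℕ} {X : Type u} [TopologicalSpace X] [ChartedSpace (EuclideanSpace ℝ (Fin n)) X]
  [IsManifold (𝓡 n) ∞ X] [ConnectedSpace X] {D : InitialDataSet (𝓡 n) X}

namespace CauchyDevelopment

/-- **The component functions of the coordinate metric of a data embedding are smooth** on
`coordSplit (ψ.target)` (hypotheses `hu₁`, `hu₂` of
`hawkingEllis_locallyUnique_vacuumDevelopment_of_reducedEquations`). [folklore] -/
theorem contDiffOn_coordMetricComps (𝒮 : DataEmbedding D)
    {ψ : OpenPartialHomeomorph 𝒮.carrier (EuclideanSpace ℝ (Fin (n + 1)))}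
    (hψ : ψ ∈ IsManifold.maximalAtlas (𝓡 (n + 1)) ∞ 𝒮.carrier) :
    ContDiffOn ℝ ∞ (coordMetricComps 𝒮 ψ) ((coordSplit n).symm ⁻¹' ψ.target) := by
  have h1 := CoordChart.contDiffOn_metricRepr 𝒮.metric.toPseudoRiemannianMetric hψ
  have h2 : ContDiffOn ℝ ∞ (fun q : ℝ × EuclideanSpace ℝ (Fin n) ↦ (coordSplit n).symm q)
      ((coordSplit n).symm ⁻¹' ψ.target) := (coordSplit n).symm.contDiff.contDiffOn
  have h3 : ContDiffOn ℝ ∞ (fun q : ℝ × EuclideanSpace ℝ (Fin n) ↦ bilinComps (n + 1)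
      (CoordChart.metricRepr 𝒮.metric.toPseudoRiemannianMetric hψ ((coordSplit n).symm q)))
      ((coordSplit n).symm ⁻¹' ψ.target) :=
    (bilinComps (n + 1)).contDiff.comp_contDiffOn (h1.comp h2 fun q hq ↦ hq)
  refine h3.congr fun q hq ↦ ?_
  exact CoordChart.bilinComps_pullbackBilin_symm 𝒮.metric.toPseudoRiemannianMetric hψ hq

/-- The domain `coordSplit (ψ.target)` is a neighbourhood of `coordSplit (ψ (ι x))` for `ι x` in the
chart source (hypothesis `hU` of `…_of_reducedEquations`). [folklore] -/
theorem coordSplit_symm_preimage_target_mem_nhds (𝒮 : DataEmbedding D)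
    {ψ : OpenPartialHomeomorph 𝒮.carrier (EuclideanSpace ℝ (Fin (n + 1)))} {x : X}
    (hx : 𝒮.embed x ∈ ψ.source) :
    (coordSplit n).symm ⁻¹' ψ.target ∈ 𝓝 (coordSplit n (ψ (𝒮.embed x))) := by
  refine ((coordSplit n).symm.continuous.isOpen_preimage _ ψ.open_target).mem_nhds ?_
  show (coordSplit n).symm (coordSplit n (ψ (𝒮.embed x))) ∈ ψ.target
  rw [ContinuousLinearEquiv.symm_apply_apply]
  exact ψ.map_source hx

/-- **The vacuum equations for a vacuum data embedding in a chart**: the coordinate Ricci form of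
the coordinate metric `ψ⁻¹* g` vanishes on the chart target. [cite: ONeill1983, Ch. 3, Prop. 3.59] -/
theorem ricAt_coordMetric_eq_zero [Fact (1 ≤ n + 1)] (𝒮 : DataEmbedding D) (h𝒮 : 𝒮.IsVacuum)
    {ψ : OpenPartialHomeomorph 𝒮.carrier (EuclideanSpace ℝ (Fin (n + 1)))}
    (hψ : ψ ∈ IsManifold.maximalAtlas (𝓡 (n + 1)) ∞ 𝒮.carrier) {p : EuclideanSpace ℝ (Fin (n + 1))}
    (hp : p ∈ ψ.target) (Y₀ Z₀ : EuclideanSpace ℝ (Fin (n + 1))) :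
    MetricCoord.ricAt (CoordChart.metricRepr 𝒮.metric.toPseudoRiemannianMetric hψ) p Y₀ Z₀ = 0 := by
  haveI := 𝒮.metric.toPseudoRiemannianMetric.hasLeviCivita
  exact CoordChart.ricAt_metricRepr_eq_zero 𝒮.metric.toPseudoRiemannianMetric hψ h𝒮 hp Y₀ Z₀

end CauchyDevelopment

end Data

end Literature.Geometry.Lorentzian
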